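/-
search for candidate a priori estimates; no regularity claim

# K78 — (R24) THE FLAT-TOP LAWS: the second-order Rayleigh test at the top of `λ₁`

Node of record (verbatim, unchanged): L-λ(q) =
`Summit.NavierStokesRegularity.FunctionalMining.TopEigHeatCoercivePos q := ∃ c > 0,`
`TopEigHeatCoercive q c` — OPEN for every real `q > 1`; (F2) killing family WANTED/OPEN. This
file proves NECESSARY CONDITIONS on an exact (F2) witness (`heatDissipation Φ_q v ≤ 0`,
`Φ_q v > 0`); it constructs none and decides no node.

SETTING. `v` smooth on `T^d`, `S = strainFlat v`, `λ₁ = torusStrainTopEig v = lam ∘ S`, top set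
`topEigSet (S x)` (unit `e`, `eᵀS(x)e = λ₁(x)`), Danskin mass `μ(x) = dirTopEig (S x) (S(Δv) x)`.
LEVER. For a FIXED vector `e` the Rayleigh quotient `φ_e(y) = eᵀS(v)(y)e` is a smooth scalar with
`φ_e ≤ λ₁` and `φ_e(x₀) = λ₁(x₀)` iff `e` is top at `x₀`; at a maximum point `x₀` of `λ₁` EVERY
top vector `e` makes `x₀` a GLOBAL maximum of `φ_e`: first derivative `0`, second derivative `≤ 0`
as a quadratic form in the direction; and `∂ₖφ_e = eᵀS(∂ₖv)e`, `∂ⱼ∂ₖφ_e = eᵀS(∂ⱼ∂ₖv)e` (§ 0).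

CONTENT (all `theorem`s, 0 `def`s; [folklore] = calculus/algebra, [ours] = new here).
§ 0 Tools (any `d`): `∂ₖ(S v) = S(∂ₖv)`, `∂ₖφ_e = eᵀS(∂ₖv)e`, derivatives of `s ↦ φ_e(x + sξ)`,
  trace `Σₖ eᵀS(∂ₖ∂ₖv)e = eᵀS(Δv)e`; a symmetric form `≤ 0` on `εⱼ, εⱼ ± εₖ`, trace `≥ 0`, vanishes.
§ 1 (R24a/b) MAX-POINT LAWS (any `d`, no divergence condition) at a maximum point `x₀` of `λ₁`, for
  every top vector `e`: (a) `eᵀS(∂ₖv)(x₀)e = 0 ∀ k`; (b) `Σⱼₖ ξⱼξₖ eᵀS(∂ⱼ∂ₖv)(x₀)e ≤ 0 ∀ ξ`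
  (K47ʼs `μ(x₀) ≤ 0` is its trace).
§ 2 (R24c) FLATNESS LEMMA: if moreover `eᵀS(Δv)(x₀)e ≥ 0` then `eᵀS(∂ⱼ∂ₖv)(x₀)e = 0 ∀ j k`.
§ 3 iso-top (`λ₁ ≡ m`): every point is a maximum point, so § 1–2 apply at EVERY point.
§ 4 EXACT WITNESSES ON `T³` (`q > 1`, heat `≤ 0`, `Φ_q > 0`; `λ₁ ≡ m > 0` by K53/K57b): [ours]
  (R24d) `μ ≡ 0` at EVERY point: `μ ≤ 0` pointwise (K47 on the frozen top), `∫ μ = 0` (Danskin on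
  the frozen top, zero heat price; cf. K48 § 2), and an upper semicontinuous nonpositive function
  vanishing a.e. vanishes everywhere (a strict dip is open with positive volume);
  (R24e) at EVERY point — crossings `λ₁ = λ₂` included — SOME top vector `e` is FULLY FLAT:
  `eᵀS(Δv)e = 0`, `eᵀS(∂ₖv)e = 0 ∀ k`, `eᵀS(∂ⱼ∂ₖv)e = 0 ∀ j k`;
  (R24f) at a SIMPLE point (`λ₂ < λ₁`) EVERY top vector (`= ±` the director) is fully flat;
  (R24g) WALL INHERITANCE: a vector `e` which is top along a set `A` of simple points is top and
  fully flat at every point of `closure A` — facet directions are continued flat into the walls.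
MEANING for the (F2) hunt. K60–K77 constrain an exact witness on the simple set `{λ₂ < λ₁}`; there
and on its closure (R24a/c/f/g) also follow from K70ʼs frozen frame with K53ʼs iso-top (`φ_e ≡ m`
locally) — reproved here from the Hessian test alone, on BUILT imports. New to the cell: § 1–2 at
the maxima of `λ₁` of ANY field, and (R24d/e) at EVERY point of an exact witness, the INTERIOR of
the crossing set `{λ₁ = λ₂}` included (where K60–K77 are silent): zero Danskin mass and a top vector
`e` with `eᵀS(∂ₖv)e = 0 ∀ k`, `eᵀS(∂ⱼ∂ₖv)e = 0 ∀ j k` — a pointwise sieve checkable on closed forms.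
NOT CLAIMED: existence or non-existence of a witness; anything at `q = 1`; no numerics.
FILING (prove seat g32, REQUEST #108): declarations byte-identical to the no-go seat's staged `TopEigHeatFlatTop.STAGING.lean` dbd267cfc6e7ef59; this line is the only addition.
-/
import Summits.NavierStokesRegularity.FunctionalMining.NoGo.TopEigHeatIsoTopLow
import Summits.NavierStokesRegularity.FunctionalMining.NoGo.TopEigHeatStationary
import Summits.NavierStokesRegularity.FunctionalMining.NoGo.TopEigHeatLevelBalance
import Summits.NavierStokesRegularity.FunctionalMining.TopEigDanskinDensityUSC
import Summits.NavierStokesRegularity.FunctionalMining.TopEigDensityIdentity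
import Summits.NavierStokesRegularity.FunctionalMining.BiaxialXRay
import HarnessLib

noncomputable section

open Filter Topology Set MeasureTheory

namespace Summit.NavierStokesRegularity.FunctionalMining

open Literature.Analysis Literature.Analysis.FunctionSpaces Literature.Analysis.FunctionSpaces.Torus
  Literature.Analysis.FluidPDE StrainL4

namespace TopEig.FlatTop

/-! ## 0. Tools: derivatives of the Rayleigh quotient of a fixed vector -/

section Tools

variable {d : Type*} [Fintype d] [DecidableEq d] {v : UnitAddTorus d → EuclideanSpace ℝ d}

/-- `Σⱼ (εₐ)ⱼ f j = f a` for the coordinate vector `εₐ = single a 1`. [folklore] -/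
theorem sum_single_mul (a : d) (f : d → ℝ) :
    ∑ j, (EuclideanSpace.single a (1 : ℝ)) j * f j = f a := by
  simp [PiLp.single_apply, ite_mul, Finset.sum_ite_eq']

/-- `Σⱼₗ (εₐ)ⱼ (ε_b)ₗ Q j l = Q a b`. [folklore] -/
theorem sum_sum_single_mul_single (a b : d) (Q : d → d → ℝ) :
    ∑ j, ∑ l, (EuclideanSpace.single a (1 : ℝ)) j * (EuclideanSpace.single b (1 : ℝ)) l * Q j l =
      Q a b := by
  simp_rw [mul_assoc, ← Finset.mul_sum, sum_single_mul]

/-- A symmetric form which is `≤ 0` on the coordinate vectors and on their sums and differences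
and has trace `≥ 0` vanishes (diagonal: each `≤ 0`, sum `0`; off-diagonal: polarisation).
[folklore] -/
theorem form_eq_zero_of_nonpos_of_trace_nonneg (Q : d → d → ℝ) (hsymm : ∀ j k, Q j k = Q k j)
    (hH : ∀ ξ : EuclideanSpace ℝ d, ∑ j, ∑ k, ξ j * ξ k * Q j k ≤ 0) (htr : 0 ≤ ∑ k, Q k k)
    (j k : d) : Q j k = 0 := by
  have hdiag_le : ∀ l, Q l l ≤ 0 := fun l => by
    have h := hH (EuclideanSpace.single l 1)
    rwa [sum_sum_single_mul_single] at h
  have hsum : ∑ l, Q l l = 0 := le_antisymm (Finset.sum_nonpos fun l _ => hdiag_le l) htr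
  have hdiag : ∀ l, Q l l = 0 := fun l =>
    (Finset.sum_eq_zero_iff_of_nonpos fun l _ => hdiag_le l).1 hsum l (Finset.mem_univ l)
  have hplus := hH (EuclideanSpace.single j 1 + EuclideanSpace.single k 1)
  have hminus := hH (EuclideanSpace.single j 1 - EuclideanSpace.single k 1)
  simp only [PiLp.add_apply, PiLp.sub_apply, add_mul, mul_add, sub_mul, mul_sub,
    Finset.sum_add_distrib, Finset.sum_sub_distrib, sum_sum_single_mul_single, hdiag]
    at hplus hminus
  linarith [hsymm j k]

/-- `∂ₖ (S v) = S (∂ₖ v)` (third derivatives commute). [folklore] -/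
theorem partialDeriv_strainFlat (hv : Torus.IsSmooth v) (k : d) (x : UnitAddTorus d) :
    Torus.partialDeriv k (strainFlat v) x = strainFlat (Torus.partialDeriv k v) x := by
  ext p
  obtain ⟨i, j⟩ := p
  rw [← EuclideanCoord.partialDeriv_apply_coord ((isSmooth_strainFlat hv).isContDiff (by simp)) k x
    (i, j)]
  exact partialDeriv_strainEntry hv k i j x

/-- `∂ₖ (eᵀS(v)e) = eᵀS(∂ₖv)e` for a FIXED vector `e`. [folklore] -/
theorem partialDeriv_quad_strainFlat (hv : Torus.IsSmooth v) (e : d → ℝ) (k : d)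
    (x : UnitAddTorus d) :
    Torus.partialDeriv k (fun y => quad (strainFlat v y) e) x =
      quad (strainFlat (Torus.partialDeriv k v) x) e := by
  set L : EuclideanSpace ℝ (d × d) →L[ℝ] ℝ :=
    ∑ i, ∑ j, (e i * e j) • (EuclideanSpace.proj (i, j) : EuclideanSpace ℝ (d × d) →L[ℝ] ℝ) with hL
  have hLA : ∀ A : EuclideanSpace ℝ (d × d), L A = quad A e := by
    intro A
    simp only [hL, FunLike.coe_sum, Finset.sum_apply, FunLike.coe_smul, Pi.smul_apply, smul_eq_mul,
      quad]
    refine Finset.sum_congr rfl fun i _ => Finset.sum_congr rfl fun j _ => ?_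
    rw [show (EuclideanSpace.proj (i, j) : EuclideanSpace ℝ (d × d) →L[ℝ] ℝ) A = A (i, j) from rfl]
    ring
  have hfun : (fun y => quad (strainFlat v y) e) = L ∘ strainFlat v :=
    funext fun y => (hLA _).symm
  rw [hfun, partialDeriv_clm_comp (isSmooth_strainFlat hv) L k x, partialDeriv_strainFlat hv k x,
    hLA]

/-- The line function `s ↦ eᵀS(v)(x + sξ)e` has derivative `Σₖ ξₖ eᵀS(∂ₖv)(x + sξ)e`. [folklore] -/
theorem hasDerivAt_quad_strainFlat_line (hv : Torus.IsSmooth v) (e : d → ℝ) (x : UnitAddTorus d)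
    (ξ : EuclideanSpace ℝ d) (s : ℝ) :
    HasDerivAt (fun t : ℝ => quad (strainFlat v (x + proj (t • ξ))) e)
      (∑ k, ξ k * quad (strainFlat (Torus.partialDeriv k v) (x + proj (s • ξ))) e) s := by
  refine (BiaxialEikonal.hasDerivAt_line (isSmooth_quad_strainFlat hv e) x ξ s).congr_deriv ?_
  rw [fderiv_apply_eq_sum_partialDeriv ((isSmooth_quad_strainFlat hv e).isContDiff (by simp))]
  refine Finset.sum_congr rfl fun k _ => ?_
  rw [partialDeriv_quad_strainFlat hv e k, smul_eq_mul]

/-- Its second derivative at `s = 0` is the Hessian form `Σⱼₖ ξⱼ ξₖ eᵀS(∂ⱼ∂ₖv)(x)e`. [folklore] -/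
theorem deriv_deriv_quad_strainFlat_line (hv : Torus.IsSmooth v) (e : d → ℝ) (x : UnitAddTorus d)
    (ξ : EuclideanSpace ℝ d) :
    deriv (deriv fun t : ℝ => quad (strainFlat v (x + proj (t • ξ))) e) 0 =
      ∑ j, ∑ k, ξ j * ξ k *
        quad (strainFlat (Torus.partialDeriv j (Torus.partialDeriv k v)) x) e := by
  have h1 : deriv (fun t : ℝ => quad (strainFlat v (x + proj (t • ξ))) e) =
      fun t => ∑ k, ξ k * quad (strainFlat (Torus.partialDeriv k v) (x + proj (t • ξ))) e :=
    funext fun t => (hasDerivAt_quad_strainFlat_line hv e x ξ t).deriv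
  have h2 : HasDerivAt
      (fun t : ℝ => ∑ k, ξ k * quad (strainFlat (Torus.partialDeriv k v) (x + proj (t • ξ))) e)
      (∑ k, ξ k * ∑ j, ξ j * quad (strainFlat (Torus.partialDeriv j (Torus.partialDeriv k v))
        (x + proj ((0 : ℝ) • ξ))) e) 0 :=
    HasDerivAt.fun_sum fun k _ =>
      (hasDerivAt_quad_strainFlat_line (hv.partialDeriv k) e x ξ 0).const_mul (ξ k)
  rw [h1, h2.deriv]
  simp only [zero_smul, proj_zero, add_zero, Finset.mul_sum]
  rw [Finset.sum_comm]
  exact Finset.sum_congr rfl fun j _ => Finset.sum_congr rfl fun k _ => by ring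

/-- Trace: `Σₖ eᵀS(∂ₖ∂ₖv)e = eᵀS(Δv)e`. [folklore] -/
theorem sum_quad_strainFlat_partialDeriv_partialDeriv (hv : Torus.IsSmooth v) (e : d → ℝ)
    (x : UnitAddTorus d) :
    ∑ k, quad (strainFlat (Torus.partialDeriv k (Torus.partialDeriv k v)) x) e =
      quad (strainFlat (Torus.laplacian v) x) e := by
  rw [quad_strainFlat_laplacian hv e x,
    laplacian_eq_sum_partialDeriv_partialDeriv (isSmooth_quad_strainFlat hv e) x]
  refine Finset.sum_congr rfl fun k _ => ?_
  have h1 : Torus.partialDeriv k (fun y => quad (strainFlat v y) e) =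
      fun y => quad (strainFlat (Torus.partialDeriv k v) y) e :=
    funext fun y => partialDeriv_quad_strainFlat hv e k y
  rw [h1, partialDeriv_quad_strainFlat (hv.partialDeriv k) e k x]

end Tools

/-! ## 1. (R24a/b) The max-point laws -/

section MaxPoint

variable {d : Type*} [Fintype d] [DecidableEq d] [Nonempty d]
  {v : UnitAddTorus d → EuclideanSpace ℝ d}

/-- At a maximum point `x₀` of `λ₁`, every top vector `e` at `x₀` makes `x₀` a GLOBAL maximum of the
Rayleigh quotient `y ↦ eᵀS(y)e` (`eᵀS(y)e ≤ λ₁(y) ≤ λ₁(x₀) = eᵀS(x₀)e`, as in K47); in particular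
every line function `t ↦ eᵀS(x₀ + tξ)e` has a maximum at `t = 0`. [folklore] -/
theorem isLocalMax_quad_strainFlat_line {x₀ : UnitAddTorus d}
    (hmax : IsMaxOn (torusStrainTopEig v) univ x₀) {e : d → ℝ}
    (he : e ∈ topEigSet (strainFlat v x₀)) (ξ : EuclideanSpace ℝ d) :
    IsLocalMax (fun t : ℝ => quad (strainFlat v (x₀ + proj (t • ξ))) e) 0 :=
  Filter.Eventually.of_forall fun t => by
    simpa only [zero_smul, proj_zero, add_zero] using
      (calc quad (strainFlat v (x₀ + proj (t • ξ))) e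
            ≤ lam (strainFlat v (x₀ + proj (t • ξ))) := quad_le_lam _ he.1
        _ = torusStrainTopEig v _ := lam_strainFlat v _
        _ ≤ torusStrainTopEig v x₀ := hmax (mem_univ _)
        _ = lam (strainFlat v x₀) := (lam_strainFlat v x₀).symm
        _ = quad (strainFlat v x₀) e := he.2.symm)

/-- **(R24a) First-order balance of every derived strain on the top direction.** At a maximum point
`x₀` of `λ₁`, for every top vector `e` and every coordinate `k`: `eᵀ S(∂ₖv)(x₀) e = 0`. [ours] -/
theorem quad_strainFlat_partialDeriv_eq_zero_of_isMaxOn (hv : Torus.IsSmooth v)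
    {x₀ : UnitAddTorus d} (hmax : IsMaxOn (torusStrainTopEig v) univ x₀) {e : d → ℝ}
    (he : e ∈ topEigSet (strainFlat v x₀)) (k : d) :
    quad (strainFlat (Torus.partialDeriv k v) x₀) e = 0 := by
  have h0 := (isLocalMax_quad_strainFlat_line hmax he _).hasDerivAt_eq_zero
    (hasDerivAt_quad_strainFlat_line hv e x₀ (EuclideanSpace.single k 1) 0)
  rwa [zero_smul, proj_zero, add_zero, sum_single_mul] at h0

/-- **(R24b) The Hessian test.** At a maximum point `x₀` of `λ₁`, for every top vector `e` the
quadratic form `ξ ↦ Σⱼₖ ξⱼ ξₖ eᵀS(∂ⱼ∂ₖv)(x₀)e` is negative semidefinite (`ξ = εₖ`: every pure second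
derivative `eᵀS(∂ₖ∂ₖv)(x₀)e ≤ 0`; trace: K47ʼs `eᵀS(Δv)(x₀)e ≤ 0`). [ours] -/
theorem hessQuad_nonpos_of_isMaxOn (hv : Torus.IsSmooth v) {x₀ : UnitAddTorus d}
    (hmax : IsMaxOn (torusStrainTopEig v) univ x₀) {e : d → ℝ}
    (he : e ∈ topEigSet (strainFlat v x₀)) (ξ : EuclideanSpace ℝ d) :
    ∑ j, ∑ k, ξ j * ξ k * quad (strainFlat (Torus.partialDeriv j (Torus.partialDeriv k v)) x₀) e
      ≤ 0 := by
  rw [← deriv_deriv_quad_strainFlat_line hv e x₀ ξ]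
  exact IsLocalMax.deriv_deriv_nonpos (isLocalMax_quad_strainFlat_line hmax he ξ)
    (hasDerivAt_quad_strainFlat_line hv e x₀ ξ 0).continuousAt

/-! ## 2. (R24c) The flatness lemma -/

/-- **(R24c) Flatness.** At a maximum point `x₀` of `λ₁`, a top vector `e` with `eᵀS(Δv)(x₀)e ≥ 0`
(hence `= 0`) has ALL second derivatives of its Rayleigh quotient zero:
`eᵀ S(∂ⱼ∂ₖv)(x₀) e = 0` for all `j, k` — a negative-semidefinite form with zero trace vanishes
(diagonal: each `≤ 0` with sum `0`; off-diagonal: polarisation on `εⱼ ± εₖ`). [ours] -/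
theorem quad_strainFlat_partialDeriv_partialDeriv_eq_zero_of_isMaxOn (hv : Torus.IsSmooth v)
    {x₀ : UnitAddTorus d} (hmax : IsMaxOn (torusStrainTopEig v) univ x₀) {e : d → ℝ}
    (he : e ∈ topEigSet (strainFlat v x₀)) (hflat : 0 ≤ quad (strainFlat (Torus.laplacian v) x₀) e)
    (j k : d) :
    quad (strainFlat (Torus.partialDeriv j (Torus.partialDeriv k v)) x₀) e = 0 :=
  form_eq_zero_of_nonpos_of_trace_nonneg
    (fun j k => quad (strainFlat (Torus.partialDeriv j (Torus.partialDeriv k v)) x₀) e)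
    (fun j k => by
      rw [show Torus.partialDeriv j (Torus.partialDeriv k v) = Torus.partialDeriv k
        (Torus.partialDeriv j v) from funext fun x => partialDeriv_comm hv j k x])
    (fun ξ => hessQuad_nonpos_of_isMaxOn hv hmax he ξ)
    (by rw [sum_quad_strainFlat_partialDeriv_partialDeriv hv e x₀]; exact hflat) j k

/-! ## 3. Iso-top fields: every point is a maximum point (so § 1–2 hold at every point) -/

omit [Nonempty d] in
/-- On an iso-top field (`λ₁ ≡ m`) every point is a maximum point of `λ₁`. [folklore] -/
theorem isMaxOn_of_torusStrainTopEig_eq_const {m : ℝ} (hm : ∀ x, torusStrainTopEig v x = m)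
    (x₀ : UnitAddTorus d) : IsMaxOn (torusStrainTopEig v) univ x₀ :=
  isMaxOn_iff.2 fun y _ => by rw [hm y, hm x₀]

end MaxPoint

/-! ## 4. Exact (F2) witnesses on `T³` -/

section Three

variable {v : UnitAddTorus (Fin 3) → EuclideanSpace ℝ (Fin 3)} {q : ℝ}

/-- The frozen top of an exact witness with `Φ_q > 0`: `λ₁ ≡ m` with `0 < m`. [ours] -/
theorem exists_const_pos_of_exact (hq : 1 < q) (hv : Torus.IsSmooth v) (hdv : Torus.IsDivFree v)
    (hT : heatDissipation (torusTopEigMoment q) v ≤ 0) (hΦ : 0 < torusTopEigMoment q v) :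
    ∃ m : ℝ, 0 < m ∧ ∀ x, torusStrainTopEig v x = m := by
  have hd : Fintype.card (Fin 3) = 3 := Fintype.card_fin 3
  refine ⟨torusStrainTopEig v 0, ?_, fun x =>
    torusStrainTopEig_eq_of_heatDissipation_nonpos_of_one_lt hd hq hv hdv hT x 0⟩
  have hm0 : 0 ≤ torusStrainTopEig v 0 := by
    rw [← lam_strainFlat]; exact lam_strainFlat_nonneg hv hdv 0
  rcases hm0.lt_or_eq with h | h
  · exact h
  have hΦm := torusTopEigMoment_eq_rpow_of_heatDissipation_nonpos_of_one_lt hd hq hv hdv hT 0 q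
  rw [← h, Real.zero_rpow (by linarith : q ≠ 0)] at hΦm
  exact absurd hΦm hΦ.ne'

/-- The Danskin mass of an exact witness integrates to zero: `∫ μ = 0` (Danskin on the frozen top
`heat_q = −(q m^{q−1}) ∫ μ`, zero heat price, `m > 0`). [ours] -/
theorem integral_dirTopEig_laplacian_eq_zero_of_exact (hq : 1 < q) (hv : Torus.IsSmooth v)
    (hdv : Torus.IsDivFree v) (hT : heatDissipation (torusTopEigMoment q) v ≤ 0)
    (hΦ : 0 < torusTopEigMoment q v) :
    ∫ x, dirTopEig (strainFlat v x) (strainFlat (Torus.laplacian v) x) = 0 := by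
  obtain ⟨m, hmpos, hm⟩ := exists_const_pos_of_exact hq hv hdv hT hΦ
  have e := heatDissipation_topEigMoment_eq_of_const hq.le hv hdv hm
  rw [heatDissipation_topEigMoment_eq_zero_of_exact_of_one_lt hq hv hdv hT hq] at e
  have hc : -(q * m ^ (q - 1)) ≠ 0 :=
    neg_ne_zero.2 (mul_ne_zero (by linarith) (Real.rpow_pos_of_pos hmpos _).ne')
  exact (mul_eq_zero.1 e.symm).resolve_left hc

/-- **(R24d) The Danskin mass of an exact witness vanishes at EVERY point**: `μ(S(x); S(Δv)(x)) = 0`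
for all `x` (`μ ≤ 0` pointwise and `∫ μ = 0` give `μ = 0` a.e.; upper semicontinuity upgrades it: a
strict dip `{μ < μ(x)/2}` is open, nonempty, of positive volume, inside the null set). [ours] -/
theorem dirTopEig_laplacian_eq_zero_of_exact (hq : 1 < q) (hv : Torus.IsSmooth v)
    (hdv : Torus.IsDivFree v) (hT : heatDissipation (torusTopEigMoment q) v ≤ 0)
    (hΦ : 0 < torusTopEigMoment q v) (x : UnitAddTorus (Fin 3)) :
    dirTopEig (strainFlat v x) (strainFlat (Torus.laplacian v) x) = 0 := by
  obtain ⟨m, -, hm⟩ := exists_const_pos_of_exact hq hv hdv hT hΦ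
  set μ : UnitAddTorus (Fin 3) → ℝ := fun y =>
    dirTopEig (strainFlat v y) (strainFlat (Torus.laplacian v) y) with hμ
  have hle : ∀ y, μ y ≤ 0 := fun y =>
    dirTopEig_laplacian_nonpos_of_isMaxOn hv (isMaxOn_of_torusStrainTopEig_eq_const hm y)
  have hint : Integrable μ volume := integrable_dirTopEig_strainFlat hv hv.laplacian hdv
  have hnull : volume {y | μ y ≠ 0} = 0 := by
    have hI' : ∫ y, (-μ) y = 0 := by
      rw [show (∫ y, (-μ) y) = -∫ y, μ y from integral_neg μ,
        integral_dirTopEig_laplacian_eq_zero_of_exact hq hv hdv hT hΦ, neg_zero]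
    have h := (integral_eq_zero_iff_of_nonneg_ae (ae_of_all _ fun y => neg_nonneg.2 (hle y))
      hint.neg).1 hI'
    rw [Filter.EventuallyEq, ae_iff] at h
    simpa using h
  show μ x = 0
  by_contra hne
  have hpos : 0 < volume (μ ⁻¹' Iio (μ x / 2)) :=
    ((upperSemicontinuous_dirTopEig_strainFlat hv hv.laplacian).isOpen_preimage _).measure_pos
      volume ⟨x, show μ x < μ x / 2 by have := lt_of_le_of_ne (hle x) hne; linarith⟩
  refine absurd (measure_mono_null (fun y (hy : μ y < μ x / 2) => ?_) hnull) hpos.ne'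
  exact ne_of_lt (by linarith [hle x])

/-- **(R24e) A fully flat top direction at EVERY point of an exact witness** — crossing points of
`λ₁ = λ₂` included: some top vector `e` at `x` has `eᵀS(Δv)(x)e = 0`, `eᵀS(∂ₖv)(x)e = 0` for all
`k`, and `eᵀS(∂ⱼ∂ₖv)(x)e = 0` for all `j, k`. [ours] -/
theorem exists_flat_topVec_of_exact (hq : 1 < q) (hv : Torus.IsSmooth v) (hdv : Torus.IsDivFree v)
    (hT : heatDissipation (torusTopEigMoment q) v ≤ 0) (hΦ : 0 < torusTopEigMoment q v)
    (x : UnitAddTorus (Fin 3)) :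
    ∃ e ∈ topEigSet (strainFlat v x), quad (strainFlat (Torus.laplacian v) x) e = 0 ∧
      (∀ k, quad (strainFlat (Torus.partialDeriv k v) x) e = 0) ∧
      ∀ j k, quad (strainFlat (Torus.partialDeriv j (Torus.partialDeriv k v)) x) e = 0 := by
  obtain ⟨m, -, hm⟩ := exists_const_pos_of_exact hq hv hdv hT hΦ
  have hmax := isMaxOn_of_torusStrainTopEig_eq_const hm x
  obtain ⟨e, he, hμ⟩ := exists_quad_eq_dirTopEig (strainFlat v x) (strainFlat (Torus.laplacian v) x)
  have h0 : quad (strainFlat (Torus.laplacian v) x) e = 0 := by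
    rw [hμ]; exact dirTopEig_laplacian_eq_zero_of_exact hq hv hdv hT hΦ x
  exact ⟨e, he, h0, fun k => quad_strainFlat_partialDeriv_eq_zero_of_isMaxOn hv hmax he k,
    fun j k => quad_strainFlat_partialDeriv_partialDeriv_eq_zero_of_isMaxOn hv hmax he h0.ge j k⟩

/-- At a simple point (`λ₂ < λ₁`) the top set is `{±n}`, so EVERY top vector realises the Danskin
mass: `fᵀ M f = μ(S(x); M)` for every `M`. [folklore] -/
theorem quad_eq_dirTopEig_of_midEig_lt (v : UnitAddTorus (Fin 3) → EuclideanSpace ℝ (Fin 3))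
    {x : UnitAddTorus (Fin 3)} (hx : torusStrainMidEig v x < torusStrainTopEig v x) {f : Fin 3 → ℝ}
    (hf : f ∈ topEigSet (strainFlat v x)) (M : EuclideanSpace ℝ (Fin 3 × Fin 3)) :
    quad M f = dirTopEig (strainFlat v x) M := by
  obtain ⟨e, he1, hSe, hg, hgap⟩ := exists_gapForm_of_midEig_lt_topEig hx
  have he1' : e ∈ unitSphere (Fin 3) := he1
  have hgf := gapForm_of_eigenvector (torusStrainMatrix_isSymm v x) he1' hSe hgap
  have hquad : quad (SharpClass.DirectorForm.flat (torusStrainMatrix v x)) e =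
      torusStrainTopEig v x := by
    rw [SharpClass.DirectorForm.quad_flat, hSe, dotProduct_smul, he1, smul_eq_mul, mul_one]
  have hpair := topEigSet_eq_pair_of_gapForm he1' hg hgf hquad
  rw [flat_torusStrainMatrix] at hpair
  rw [dirTopEig_eq_quad_of_topEigSet_eq_pair hpair]
  rw [hpair] at hf
  simp only [mem_insert_iff, mem_singleton_iff] at hf
  rcases hf with rfl | rfl
  · rfl
  · exact quad_neg_vec M e

/-- **(R24f) At a simple point of an exact witness EVERY top vector is fully flat**:
`fᵀS(∂ⱼ∂ₖv)(x)f = 0` for all `j, k` (and `fᵀS(Δv)(x)f = μ(x) = 0`). [ours] -/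
theorem flat_of_exact_of_midEig_lt (hq : 1 < q) (hv : Torus.IsSmooth v) (hdv : Torus.IsDivFree v)
    (hT : heatDissipation (torusTopEigMoment q) v ≤ 0) (hΦ : 0 < torusTopEigMoment q v)
    {x : UnitAddTorus (Fin 3)} (hx : torusStrainMidEig v x < torusStrainTopEig v x) {f : Fin 3 → ℝ}
    (hf : f ∈ topEigSet (strainFlat v x)) (j k : Fin 3) :
    quad (strainFlat (Torus.partialDeriv j (Torus.partialDeriv k v)) x) f = 0 := by
  obtain ⟨m, -, hm⟩ := exists_const_pos_of_exact hq hv hdv hT hΦ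
  have h0 : quad (strainFlat (Torus.laplacian v) x) f = 0 := by
    rw [quad_eq_dirTopEig_of_midEig_lt v hx hf]
    exact dirTopEig_laplacian_eq_zero_of_exact hq hv hdv hT hΦ x
  exact quad_strainFlat_partialDeriv_partialDeriv_eq_zero_of_isMaxOn hv
    (isMaxOn_of_torusStrainTopEig_eq_const hm x) hf h0.ge j k

/-- **(R24g) Wall inheritance.** Let `e` be a fixed vector which is a top vector at every point of a
set `A` of SIMPLE points of an exact witness. Then at every point `x₀` of `closure A` — in
particular at crossing points on the wall of the facet `A` — `e` is still a top vector, its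
Danskin value is zero, and it is fully flat: `eᵀS(∂ⱼ∂ₖv)(x₀)e = 0` for all `j, k`. [ours] -/
theorem wall_inheritance_of_exact (hq : 1 < q) (hv : Torus.IsSmooth v) (hdv : Torus.IsDivFree v)
    (hT : heatDissipation (torusTopEigMoment q) v ≤ 0) (hΦ : 0 < torusTopEigMoment q v)
    {A : Set (UnitAddTorus (Fin 3))} {e : Fin 3 → ℝ}
    (hA : ∀ y ∈ A, torusStrainMidEig v y < torusStrainTopEig v y ∧ e ∈ topEigSet (strainFlat v y))
    {x₀ : UnitAddTorus (Fin 3)} (hx₀ : x₀ ∈ closure A) :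
    e ∈ topEigSet (strainFlat v x₀) ∧ quad (strainFlat (Torus.laplacian v) x₀) e = 0 ∧
      ∀ j k, quad (strainFlat (Torus.partialDeriv j (Torus.partialDeriv k v)) x₀) e = 0 := by
  obtain ⟨m, -, hm⟩ := exists_const_pos_of_exact hq hv hdv hT hΦ
  obtain ⟨y₀, hy₀⟩ := closure_nonempty_iff.1 ⟨x₀, hx₀⟩
  have he1 : e ∈ unitSphere (Fin 3) := ((hA y₀ hy₀).2).1
  have hc1 : IsClosed {y | quad (strainFlat v y) e = torusStrainTopEig v y} :=
    isClosed_eq (isSmooth_quad_strainFlat hv e).continuous (continuous_torusStrainTopEig hv)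
  have hc2 : IsClosed {y | quad (strainFlat (Torus.laplacian v) y) e = 0} :=
    isClosed_eq (isSmooth_quad_strainFlat hv.laplacian e).continuous continuous_const
  have hA1 : A ⊆ {y | quad (strainFlat v y) e = torusStrainTopEig v y} := fun y hy => by
    show quad (strainFlat v y) e = torusStrainTopEig v y
    rw [← lam_strainFlat]; exact ((hA y hy).2).2
  have hA2 : A ⊆ {y | quad (strainFlat (Torus.laplacian v) y) e = 0} := fun y hy => by
    show quad (strainFlat (Torus.laplacian v) y) e = 0
    rw [quad_eq_dirTopEig_of_midEig_lt v (hA y hy).1 (hA y hy).2]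
    exact dirTopEig_laplacian_eq_zero_of_exact hq hv hdv hT hΦ y
  have h1 : quad (strainFlat v x₀) e = torusStrainTopEig v x₀ := closure_minimal hA1 hc1 hx₀
  have h2 : quad (strainFlat (Torus.laplacian v) x₀) e = 0 := closure_minimal hA2 hc2 hx₀
  have htop : e ∈ topEigSet (strainFlat v x₀) := ⟨he1, by rw [h1, lam_strainFlat]⟩
  exact ⟨htop, h2, fun j k => quad_strainFlat_partialDeriv_partialDeriv_eq_zero_of_isMaxOn hv
    (isMaxOn_of_torusStrainTopEig_eq_const hm x₀) htop h2.ge j k⟩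

end Three

end TopEig.FlatTop

end Summit.NavierStokesRegularity.FunctionalMining

end
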